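/-
Copyright (c) 2026 the pub-hodgecm-mathlib formalisation cell (harness21).  Prover seat hodgecm-mathlib-K2Liu-p26 (g4) on loan to SLAB R90-TF, section S1 «Ch. 10∕12 local»
(dealer R90-C10-plan (g4), R-S1-48, chair VALVE 42): (W-9) TOOL FILE «ADDITIVE-CHARACTER ORTHOGONALITY ON THE BALLS OF THE FIXED PART» at a (wild) place — producer-side
infrastructure for P-wild-1's inner additive sums (SCOUT `R90/R90-C10-p08/g3/SCOUT-PWILD1.v1.md` §(3)(b), consumer R90-C10-p08 (g3)); crux H413 = `stmt-HodgeConjecture-24833`.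
KERNEL module: THEOREMS ONLY (no definition, no named fact, no `sorry`, no instance, no notation).  2026-09-05.
-/
import Summits.HodgeConjecture.HodgeConjecture.Theorems.R90S1WildFixedUnitCharacterMasses   -- ★ p865206 (W-2c): `measurableSet_nearBall` (the balls `x₀ + B⁺_j`); brings ★ `R90S1BposRamFixedUnitsHaar` (the `R⁺`-Haar frame)
import HarnessLib

/-!
# R90 · S1 ∕ U4Keys wild leaf — (W-9) TOOL FILE: ADDITIVE-CHARACTER ORTHOGONALITY ON THE BALLS `B⁺_j` OF THE FIXED PART `R⁺`
# (`Theorems/R90S1WildAdditiveBallOrthogonality.lean`; ns `Summit.HodgeConjecture.HodgeConjecture.R90.S1.WildAdditiveBallOrthogonality`)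

FRAME (= ★ `R90S1BposRamFixedUnitsHaar` ∕ ★ `R90S1WildFixedUnitCharacterMasses` VERBATIM): `R = LocalRing L v` (`= L ⊗ L⁺_v`), `σ = conjLocal L c̄ v`, `R⁺ = HeisRing.fixedPart σ`
(an additive subgroup of `R`, ★ `InvolutionRingFixedDecomposition`), `w : PlacesOver L v`, a uniformiser letter `hϖ : Valued.v ϖ = WithZero.exp (-1 : ℤ)` of `L_w`, and the BALLS
OF THE FIXED PART `B⁺_j := {c ∈ R⁺ : |c_w|_w ≤ |ϖ|^j}` (the `x₀ = 0` reading of ★ (W-2c)'s `x₀ + B⁺_j`; spelled inline); a measure `ν` on `R⁺` which is only assumed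
LEFT-INVARIANT under addition (no regularity, no finiteness).

Print: [WeilBNT1967] Ch. II §5 Cor. 2 of Prop. 3 (a non-trivial character of a compact group integrates to zero; for an additive character `ψ` of a local field and a ball `B`,
`∫_B ψ = 0` unless `ψ|_B = 1`) and Ch. I §2 (balls of an ultrametric field are compact open additive subgroups); [Serre1979] Ch. XIV §6 (local Gauss sums: the same
orthogonality is the engine of `|G(χ, ψ)|² = q^{a(χ)}`).

## WHAT THIS FILE PROVES (hypothesis-first, place-parity-free; consumer = P-wild-1's inner additive sums over the `σ`-fixed balls)
* §0 `varpi_pow_le_one`, `mem_ball_add_iff` (the balls are additive subgroups: ultrametric inequality), `measurableSet_ball` (★ `measurableSet_nearBall` at `x₀ = 0`, by name),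
  `ball_subset_ball_zero` (`B⁺_j ⊆ B⁺_0`).
* §1 **`setIntegral_ball_eq_zero_of_addChar_witness`** — for ANY `ψ : R⁺ → ℂ` multiplicative on sums (`ψ (a + b) = ψ a · ψ b`) and ANY left-invariant `ν`: if some `c₁ ∈ B⁺_j`
  has `ψ c₁ ≠ 1` then `∫_{B⁺_j} ψ dν = 0`.  Proof: the translation `c ↦ c₁ + c` is a measure-preserving homeomorphism of `R⁺` mapping `B⁺_j` onto itself, so
  `I = ∫_{B⁺_j} ψ(c₁ + c) dν(c) = ψ(c₁) · I` (Mathlib `measurePreserving_add_left`, `MeasurePreserving.setIntegral_preimage_emb`), hence `(ψ c₁ − 1) · I = 0` — the ADDITIVE twin of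
  ★ (W-2c) §2's `I = −I` (`setIntegral_nearBall_dite_eq_zero_of_le`).  NO measurability ∕ boundedness ∕ finiteness hypothesis is needed (the substitution rule holds for every
  integrand; a non-integrable `ψ` has junk integral `0`, which satisfies the conclusion).
* §2 **`setIntegral_ball_zero_diff_ball_eq`** — the shell decomposition `∫_{B⁺_0 ∖ B⁺_j} f = ∫_{B⁺_0} f − ∫_{B⁺_j} f` for `f` integrable on `B⁺_0` (Mathlib `setIntegral_sdiff`,
  §0).  [The fixed-units reading `{c : |c_w| = 1} = B⁺_0 ∖ B⁺_2` at a RAMIFIED place (even `w`-order of fixed elements) is NOT typed here: no ★ head states it; the consumer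
  takes it as its one letter `hC` (dealer R-S1-48 (c), ONE-LETTER style).]
HONEST LABEL: infrastructure; pays NO socket ((S-W) of U4Keys :182 stays OPEN over its three named wild sockets); HC_CM is proved only modulo the 7 printed citations
(2 remaining named inputs: hLiu418 = `stmt-HodgeConjecture-24832`, h413 = `stmt-HodgeConjecture-24833`) until rung 0 closes; REL ≠ ★ ≠ BUILT; count-neutral.

## References
* [WeilBNT1967] A. Weil, *Basic Number Theory*, Grundlehren 144, Springer (1967), Ch. I §2; Ch. II §5 (Prop. 3 and Cor. 2).
* [Serre1979] J.-P. Serre, *Local Fields*, GTM 67, Springer (1979), Ch. XIV §6.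
-/

set_option autoImplicit false
set_option linter.dupNamespace false

noncomputable section

open NumberField IsDedekindDomain MeasureTheory Measure Topology Set
open scoped NNReal ENNReal
open Literature.NumberTheory Literature.NumberTheory.Automorphic Literature.NumberTheory.Automorphic.UnitaryGroup
open Summit.HodgeConjecture.HodgeConjecture.R90.S1.WildFixedUnitCharacterMasses

namespace Summit.HodgeConjecture.HodgeConjecture.R90.S1.WildAdditiveBallOrthogonality

variable (L : Type) [Field L] [NumberField L] [IsCMField L] (v : HeightOneSpectrum (𝓞 ↥(maximalRealSubfield L))) (w : PlacesOver L v)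

/-! ## §0 The balls `B⁺_j = {c ∈ R⁺ : |c_w| ≤ |ϖ|^j}` of the fixed part: additive subgroups, measurable, nested -/

omit [IsCMField L] in
/-- `|ϖ|^j ≤ 1` for a uniformiser `ϖ` (`|ϖ| = exp(−1) < 1`). [cite: WeilBNT1967, Ch. I §2] -/
theorem varpi_pow_le_one {ϖ : w.1.adicCompletion L} (hϖ : Valued.v ϖ = WithZero.exp (-1 : ℤ)) (j : ℕ) : Valued.v ϖ ^ j ≤ 1 := by
  refine pow_le_one₀ zero_le ?_
  rw [hϖ, ← WithZero.exp_zero]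
  exact WithZero.exp_le_exp.2 (by norm_num)

/-- **The balls of the fixed part are additive subgroups** (ultrametric inequality): for `c₁ ∈ B⁺_j`, `c₁ + c ∈ B⁺_j ↔ c ∈ B⁺_j`. [cite: WeilBNT1967, Ch. I §2] -/
theorem mem_ball_add_iff {ϖ : w.1.adicCompletion L} (j : ℕ)
    {c₁ : ↥(HeisRing.fixedPart (conjLocal L (IsCMField.complexConj L) v))} (hc₁ : Valued.v ((c₁ : LocalRing L v) w) ≤ Valued.v ϖ ^ j)
    (c : ↥(HeisRing.fixedPart (conjLocal L (IsCMField.complexConj L) v))) :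
    Valued.v (((c₁ + c : ↥(HeisRing.fixedPart (conjLocal L (IsCMField.complexConj L) v))) : LocalRing L v) w) ≤ Valued.v ϖ ^ j ↔
      Valued.v ((c : LocalRing L v) w) ≤ Valued.v ϖ ^ j := by
  have hadd : (((c₁ + c : ↥(HeisRing.fixedPart (conjLocal L (IsCMField.complexConj L) v))) : LocalRing L v) w) = (c₁ : LocalRing L v) w + (c : LocalRing L v) w := by
    rw [AddSubgroup.coe_add, Pi.add_apply]
  rw [hadd]
  refine ⟨fun h => ?_, fun h => (Valuation.map_add _ _ _).trans (max_le hc₁ h)⟩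
  have e : (c : LocalRing L v) w = ((c₁ : LocalRing L v) w + (c : LocalRing L v) w) - (c₁ : LocalRing L v) w := by ring
  rw [e]
  exact (Valuation.map_sub _ _ _).trans (max_le h hc₁)

/-- **`B⁺_j` is measurable** — ★ (W-2c) `measurableSet_nearBall` at the centre `x₀ = 0`. [cite: WeilBNT1967, Ch. I §2] -/
theorem measurableSet_ball [MeasurableSpace (LocalRing L v)] [BorelSpace (LocalRing L v)] {ϖ : w.1.adicCompletion L} (hϖ : Valued.v ϖ = WithZero.exp (-1 : ℤ)) (j : ℕ) :
    MeasurableSet {c : ↥(HeisRing.fixedPart (conjLocal L (IsCMField.complexConj L) v)) | Valued.v ((c : LocalRing L v) w) ≤ Valued.v ϖ ^ j} := by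
  simpa only [sub_zero] using measurableSet_nearBall L v w hϖ (0 : LocalRing L v) j

/-- **`B⁺_j ⊆ B⁺_0`** (`|ϖ|^j ≤ 1 = |ϖ|^0`). [cite: WeilBNT1967, Ch. I §2] -/
theorem ball_subset_ball_zero {ϖ : w.1.adicCompletion L} (hϖ : Valued.v ϖ = WithZero.exp (-1 : ℤ)) (j : ℕ) :
    {c : ↥(HeisRing.fixedPart (conjLocal L (IsCMField.complexConj L) v)) | Valued.v ((c : LocalRing L v) w) ≤ Valued.v ϖ ^ j} ⊆
      {c : ↥(HeisRing.fixedPart (conjLocal L (IsCMField.complexConj L) v)) | Valued.v ((c : LocalRing L v) w) ≤ Valued.v ϖ ^ 0} := fun c hc => by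
  rw [Set.mem_setOf_eq, pow_zero]
  exact hc.trans (varpi_pow_le_one L v w hϖ j)

/-! ## §1 ORTHOGONALITY: a character of `(R⁺, +)` non-trivial on the ball integrates to zero over it -/

section Haar

variable [MeasurableSpace (LocalRing L v)] [BorelSpace (LocalRing L v)]
  (ν : Measure ↥(HeisRing.fixedPart (conjLocal L (IsCMField.complexConj L) v))) [ν.IsAddLeftInvariant]

/-- **ADDITIVE-CHARACTER ORTHOGONALITY ON `B⁺_j`.**  For every `ψ : R⁺ → ℂ` multiplicative on sums and every left-invariant measure `ν` on `R⁺`: if `ψ c₁ ≠ 1` for some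
`c₁ ∈ B⁺_j`, then `∫_{B⁺_j} ψ dν = 0`.  The translation `c ↦ c₁ + c` is a `ν`-preserving homeomorphism of `R⁺` with `(c₁ + ·)⁻¹(B⁺_j) = B⁺_j` (§0), so
`∫_{B⁺_j} ψ = ∫_{B⁺_j} ψ(c₁ + c) dν(c) = ψ(c₁) · ∫_{B⁺_j} ψ`, and `ψ c₁ ≠ 1` forces the integral to vanish.  No measurability, boundedness or finiteness hypothesis (the substitution
rule ★ `MeasurePreserving.setIntegral_preimage_emb` holds for every integrand).  The additive twin of ★ `setIntegral_nearBall_dite_eq_zero_of_le`'s `I = −I`.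
[cite: WeilBNT1967, Ch. II §5 Prop. 3 Cor. 2] [cite: Serre1979, Ch. XIV §6] -/
theorem setIntegral_ball_eq_zero_of_addChar_witness {ϖ : w.1.adicCompletion L}
    (ψ : ↥(HeisRing.fixedPart (conjLocal L (IsCMField.complexConj L) v)) → ℂ) (hψadd : ∀ a b, ψ (a + b) = ψ a * ψ b) (j : ℕ)
    {c₁ : ↥(HeisRing.fixedPart (conjLocal L (IsCMField.complexConj L) v))} (hc₁ : Valued.v ((c₁ : LocalRing L v) w) ≤ Valued.v ϖ ^ j) (hne : ψ c₁ ≠ 1) :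
    ∫ c in {c : ↥(HeisRing.fixedPart (conjLocal L (IsCMField.complexConj L) v)) | Valued.v ((c : LocalRing L v) w) ≤ Valued.v ϖ ^ j}, ψ c ∂ν = 0 := by
  -- the translation by `c₁` maps the ball onto itself and preserves `ν`
  have hpre : (fun c : ↥(HeisRing.fixedPart (conjLocal L (IsCMField.complexConj L) v)) => c₁ + c) ⁻¹'
      {c : ↥(HeisRing.fixedPart (conjLocal L (IsCMField.complexConj L) v)) | Valued.v ((c : LocalRing L v) w) ≤ Valued.v ϖ ^ j} =
        {c : ↥(HeisRing.fixedPart (conjLocal L (IsCMField.complexConj L) v)) | Valued.v ((c : LocalRing L v) w) ≤ Valued.v ϖ ^ j} := by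
    ext c
    rw [Set.mem_preimage, Set.mem_setOf_eq, Set.mem_setOf_eq]
    exact mem_ball_add_iff L v w j hc₁ c
  have key := (measurePreserving_add_left ν c₁).setIntegral_preimage_emb (Homeomorph.addLeft c₁).measurableEmbedding ψ
    {c : ↥(HeisRing.fixedPart (conjLocal L (IsCMField.complexConj L) v)) | Valued.v ((c : LocalRing L v) w) ≤ Valued.v ϖ ^ j}
  rw [hpre] at key
  -- `key : ∫_{B} ψ (c₁ + c) = ∫_{B} ψ c`; the integrand on the left is `ψ c₁ * ψ c`
  have key2 : ∫ c in {c : ↥(HeisRing.fixedPart (conjLocal L (IsCMField.complexConj L) v)) | Valued.v ((c : LocalRing L v) w) ≤ Valued.v ϖ ^ j}, ψ c₁ * ψ c ∂ν =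
      ∫ c in {c : ↥(HeisRing.fixedPart (conjLocal L (IsCMField.complexConj L) v)) | Valued.v ((c : LocalRing L v) w) ≤ Valued.v ϖ ^ j}, ψ c ∂ν := by
    rw [← key]
    exact integral_congr_ae (Filter.Eventually.of_forall fun c => (hψadd c₁ c).symm)
  rw [integral_const_mul] at key2
  -- `key2 : ψ c₁ * I = I`
  have h : (ψ c₁ - 1) * ∫ c in {c : ↥(HeisRing.fixedPart (conjLocal L (IsCMField.complexConj L) v)) | Valued.v ((c : LocalRing L v) w) ≤ Valued.v ϖ ^ j}, ψ c ∂ν = 0 := by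
    rw [sub_mul, one_mul, key2, sub_self]
  exact (mul_eq_zero.1 h).resolve_left (sub_ne_zero.2 hne)

/-! ## §2 The shell `B⁺_0 ∖ B⁺_j` -/

omit [ν.IsAddLeftInvariant] in
/-- **`∫_{B⁺_0 ∖ B⁺_j} f = ∫_{B⁺_0} f − ∫_{B⁺_j} f`** for `f` integrable on `B⁺_0` (Mathlib `setIntegral_sdiff`; `B⁺_j` measurable and inside `B⁺_0`, §0). [cite: WeilBNT1967, Ch. II §5] -/
theorem setIntegral_ball_zero_diff_ball_eq {ϖ : w.1.adicCompletion L} (hϖ : Valued.v ϖ = WithZero.exp (-1 : ℤ))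
    (f : ↥(HeisRing.fixedPart (conjLocal L (IsCMField.complexConj L) v)) → ℂ)
    (hf : IntegrableOn f {c : ↥(HeisRing.fixedPart (conjLocal L (IsCMField.complexConj L) v)) | Valued.v ((c : LocalRing L v) w) ≤ Valued.v ϖ ^ 0} ν) (j : ℕ) :
    ∫ c in {c : ↥(HeisRing.fixedPart (conjLocal L (IsCMField.complexConj L) v)) | Valued.v ((c : LocalRing L v) w) ≤ Valued.v ϖ ^ 0} \
        {c : ↥(HeisRing.fixedPart (conjLocal L (IsCMField.complexConj L) v)) | Valued.v ((c : LocalRing L v) w) ≤ Valued.v ϖ ^ j}, f c ∂ν =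
      (∫ c in {c : ↥(HeisRing.fixedPart (conjLocal L (IsCMField.complexConj L) v)) | Valued.v ((c : LocalRing L v) w) ≤ Valued.v ϖ ^ 0}, f c ∂ν) -
        ∫ c in {c : ↥(HeisRing.fixedPart (conjLocal L (IsCMField.complexConj L) v)) | Valued.v ((c : LocalRing L v) w) ≤ Valued.v ϖ ^ j}, f c ∂ν :=
  setIntegral_sdiff (measurableSet_ball L v w hϖ j) hf (ball_subset_ball_zero L v w hϖ j)

end Haar

end Summit.HodgeConjecture.HodgeConjecture.R90.S1.WildAdditiveBallOrthogonality

end
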